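import Summits.CriticalPhenomena.PercolationContinuityZ3.Theorems.PercNearOneGluingNoHeavyQuantCornerRun
import HarnessLib

/-!
# QUANT lane R8, T-DEC: the CORNER THEOREM, part 1 — invariants of the corner run and SOUNDNESS of the corner certificate (N45 (2)/(4))

builds on p205010 (kernel theorem, internal audit signed; external expert review pending)

Support file (`--supports stmt-CriticalPhenomena-4575`), QUANT lane typer seat prim-quant-stmt (gen 23), rung R8 of
`run/shared/lean/prim/quant/LADDER.md`.  Theorems only; standard axioms, no sorries.  Continues `…QuantCornerRun` (p305245: the corner run
`cornerFlow`, `CornerSucceeds`, the typed `CornerTheorem`).  Part 2 (`…QuantCornerTheorem`: completeness and `cornerTheorem_holds`) follows.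

* stage bookkeeping `cornerPair_fst_le/snd_le`, `cornerPair_index` (stage `n < (j′+1)²` treats the pair of index `n`), `cornerUpdate_eq_add`.
* **`cornerFlow_inv`** — for every stage `n ≤ (j′+1)²` (`0 < x < 1`, nonnegative law): entries `≥ 0`; a nonzero entry sits on an admissible
  pair (low `l ≤ j′`, mid `h ≤ min(j′,M)`, `T < l + h`) of stage index `< n`; rows ship at most their mass; columns are loaded at most to
  capacity.  Plain induction on `n`.
* **`flowAtT_of_cornerSucceeds`** (`cornerTheorem_mpr`) — SOUNDNESS: if the corner run succeeds, `FlowAtT x T j′ M μ`; the witness is the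
  corner flow into the mids plus the leftovers of the lows split over the giants proportionally to their masses (rows exact by
  `Σ_giants μ / G = 1`, or all leftovers vanish when `G = 0`; giant columns by `usage = x/(1−x)` and the certificate; mid columns by the
  invariant).  This is the direction that turns the corner run into a PROOF DEVICE for DEC of explicit laws (no LP, no flow to guess).

[this work]; `…QuantLawDecFlows` (typer g22), `…QuantLawDecUsageMonge(Rates)` (lead g21), `…QuantFlowUncross/CornerRun` (this seat).
Nothing here is cited as a published result.  The gluing rows served [cite: KozmaNitzan2024, Conjecture 3 (p. 15)]; product measure
[cite: Grimmett1999, §1.3 p. 10].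
-/

noncomputable section

namespace Summit.CriticalPhenomena.PercolationContinuityZ3.Theorems

namespace Quant

open Finset

namespace LawDec

/-! ### Stage indices -/

/-- the low of stage `n` is `≤ j′`. -/
theorem cornerPair_fst_le (j' n : ℕ) : (cornerPair j' n).1 ≤ j' := Nat.sub_le _ _

/-- the mid of stage `n` is `≤ j′`. -/
theorem cornerPair_snd_le (j' n : ℕ) : (cornerPair j' n).2 ≤ j' := by
  unfold cornerPair
  exact Nat.lt_succ_iff.1 (Nat.mod_lt _ (Nat.succ_pos _))

/-- the stage index of the pair of stage `n < (j′+1)²` is `n`. -/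
theorem cornerPair_index (j' n : ℕ) (hn : n < (j' + 1) * (j' + 1)) :
    (j' - (cornerPair j' n).1) * (j' + 1) + (cornerPair j' n).2 = n := by
  unfold cornerPair
  have hq : n / (j' + 1) ≤ j' := Nat.lt_succ_iff.1 ((Nat.div_lt_iff_lt_mul (Nat.succ_pos _)).2 hn)
  dsimp only
  rw [Nat.sub_sub_self hq]
  have := Nat.div_add_mod n (j' + 1)
  rw [mul_comm]
  omega

/-! ### Invariants of the corner run -/

/-- at an admissible stage whose entry is still `0`, the update ADDS the shipped amount on that entry. -/
theorem cornerUpdate_eq_add (x T : ℝ) (j' M : ℕ) (μ : ℕ → ℝ) (F : ℕ → ℕ → ℝ) (l h : ℕ) (hF0 : F l h = 0)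
    (hlow : 2 * (l : ℝ) < T) (hhM : h ≤ M) (hcomp : T < (l : ℝ) + h) :
    cornerUpdate x T j' M μ F (l, h) = fun a b => F a b
      + min (μ l - ∑ h' ∈ Finset.range (M + 1), F l h')
          ((μ h - ∑ l' ∈ Finset.range (j' + 1), usage x T j' l' h * F l' h) / usage x T j' l h)
        * (if a = l then (1:ℝ) else 0) * (if b = h then (1:ℝ) else 0) := by
  funext a b
  by_cases hab : a = l ∧ b = h
  · rw [hab.1, hab.2, cornerUpdate_apply_self x T j' M μ F l h hlow hhM hcomp, if_pos rfl, if_pos rfl, hF0]; ring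
  · rw [cornerUpdate_apply_of_ne x T j' M μ F (l, h) a b (by
      by_cases ha : a = l
      · exact Or.inr (fun hb => hab ⟨ha, hb⟩)
      · exact Or.inl ha)]
    by_cases ha : a = l
    · have hb : b ≠ h := fun hb => hab ⟨ha, hb⟩
      rw [if_neg hb]; ring
    · rw [if_neg ha]; ring

/-- **INVARIANTS OF THE CORNER RUN** (`0 < x < 1`, nonnegative law), for every stage `n ≤ (j′+1)²`: entries are `≥ 0`; a nonzero entry sits
on an admissible pair (low `l ≤ j′`, mid `h ≤ min(j′,M)`, `T < l + h`) already processed (stage index `(j′−l)(j′+1)+h < n`); every row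
ships at most its mass; every column is loaded at most to its capacity. [this work] -/
theorem cornerFlow_inv (x T : ℝ) (j' M : ℕ) (μ : ℕ → ℝ) (hx0 : 0 < x) (hx1 : x < 1) (hμ : ∀ k, 0 ≤ μ k) :
    ∀ n : ℕ, n ≤ (j' + 1) * (j' + 1) →
      (∀ l h, 0 ≤ cornerFlow x T j' M μ n l h) ∧
      (∀ l h, cornerFlow x T j' M μ n l h ≠ 0 →
        l ≤ j' ∧ h ≤ j' ∧ 2 * (l : ℝ) < T ∧ h ≤ M ∧ T < (l : ℝ) + h ∧ (j' - l) * (j' + 1) + h < n) ∧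
      (∀ l, ∑ h ∈ Finset.range (M + 1), cornerFlow x T j' M μ n l h ≤ μ l) ∧
      (∀ h, ∑ l ∈ Finset.range (j' + 1), usage x T j' l h * cornerFlow x T j' M μ n l h ≤ μ h) := by
  intro n
  induction n with
  | zero =>
    intro _
    refine ⟨fun l h => le_rfl, fun l h hne => absurd rfl hne, fun l => ?_, fun h => ?_⟩
    · simp only [cornerFlow_zero, Finset.sum_const_zero]; exact hμ l
    · simp only [cornerFlow_zero, mul_zero, Finset.sum_const_zero]; exact hμ h
  | succ n ih =>
    intro hn
    obtain ⟨h0, hsup, hrow, hcol⟩ := ih (by omega)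
    rw [cornerFlow_succ]
    -- the pair of stage n
    obtain ⟨l, hh, hp⟩ : ∃ l h : ℕ, cornerPair j' n = (l, h) := ⟨_, _, rfl⟩
    have hlj : l ≤ j' := by have := cornerPair_fst_le j' n; rw [hp] at this; exact this
    have hhj : hh ≤ j' := by have := cornerPair_snd_le j' n; rw [hp] at this; exact this
    have hidx : (j' - l) * (j' + 1) + hh = n := by have := cornerPair_index j' n (by omega); rw [hp] at this; exact this
    rw [hp]
    by_cases hadm : 2 * (l : ℝ) < T ∧ hh ≤ M ∧ T < (l : ℝ) + hh
    · obtain ⟨hlow, hhM, hcomp⟩ := hadm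
      -- the entry is still 0
      have hF0 : cornerFlow x T j' M μ n l hh = 0 := by
        by_contra hne
        have := (hsup l hh hne).2.2.2.2.2
        omega
      have hlh : l < hh := by
        by_contra hge
        push Not at hge
        have : (hh : ℝ) ≤ l := by exact_mod_cast hge
        linarith
      have hu : 0 < usage x T j' l hh := usage_pos_of_compat x T j' l hh hx0 hx1 hlow hlh (Or.inr hcomp)
      rw [cornerUpdate_eq_add x T j' M μ _ l hh hF0 hlow hhM hcomp]
      generalize ht : min (μ l - ∑ h' ∈ Finset.range (M + 1), cornerFlow x T j' M μ n l h')
          ((μ hh - ∑ l' ∈ Finset.range (j' + 1), usage x T j' l' hh * cornerFlow x T j' M μ n l' hh) / usage x T j' l hh) = t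
      have ht1 : t ≤ μ l - ∑ h' ∈ Finset.range (M + 1), cornerFlow x T j' M μ n l h' := ht ▸ min_le_left _ _
      have ht2 : usage x T j' l hh * t
          ≤ μ hh - ∑ l' ∈ Finset.range (j' + 1), usage x T j' l' hh * cornerFlow x T j' M μ n l' hh := by
        have h2 := ht ▸ min_le_right _ _
        rw [le_div_iff₀ hu] at h2
        linarith
      have ht0 : 0 ≤ t := by
        rw [← ht]
        refine le_min ?_ (div_nonneg ?_ hu.le)
        · linarith [hrow l]
        · linarith [hcol hh]
      have ind_nn : ∀ (P : Prop) [Decidable P], (0:ℝ) ≤ (if P then (1:ℝ) else 0) := fun P _ => by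
        split_ifs <;> norm_num
      refine ⟨?_, ?_, ?_, ?_⟩
      · intro a b
        dsimp only
        have := h0 a b
        have := mul_nonneg (mul_nonneg ht0 (ind_nn (a = l))) (ind_nn (b = hh))
        linarith
      · intro a b hne
        dsimp only at hne
        by_cases hab : a = l ∧ b = hh
        · rw [hab.1, hab.2]; exact ⟨hlj, hhj, hlow, hhM, hcomp, by omega⟩
        · have hz : t * (if a = l then (1:ℝ) else 0) * (if b = hh then (1:ℝ) else 0) = 0 := by
            by_cases ha : a = l
            · rw [if_neg (fun hb => hab ⟨ha, hb⟩)]; ring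
            · rw [if_neg ha]; ring
          rw [hz, add_zero] at hne
          obtain ⟨h1, h2, h3, h4, h5, h6⟩ := hsup a b hne
          exact ⟨h1, h2, h3, h4, h5, by omega⟩
      · intro a
        dsimp only
        have hr := BlobDec2.sum_range_const_indicator M hh hhM (t * (if a = l then (1:ℝ) else 0))
        simp only [Finset.sum_add_distrib]
        rw [hr]
        by_cases ha : a = l
        · rw [ha, if_pos rfl]; linarith
        · rw [if_neg ha]; linarith [hrow a]
      · intro b
        dsimp only
        have hlr : l ∈ Finset.range (j' + 1) := Finset.mem_range.2 (by omega)
        have e : ∀ a, usage x T j' a b * (cornerFlow x T j' M μ n a b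
            + t * (if a = l then (1:ℝ) else 0) * (if b = hh then (1:ℝ) else 0))
            = usage x T j' a b * cornerFlow x T j' M μ n a b
              + (t * (if b = hh then (1:ℝ) else 0) * usage x T j' a b) * (if a = l then (1:ℝ) else 0) := fun a => by ring
        have hs := sum_mul_indicator_eq _ (fun a => t * (if b = hh then (1:ℝ) else 0) * usage x T j' a b) l hlr
        simp only [e, Finset.sum_add_distrib]
        rw [hs]
        by_cases hb : b = hh
        · rw [hb, if_pos rfl]; linarith
        · rw [if_neg hb]; linarith [hcol b]
    · rw [cornerUpdate_of_not_admissible x T j' M μ _ (l, hh) hadm]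
      exact ⟨h0, fun a b hne => by obtain ⟨h1, h2, h3, h4, h5, h6⟩ := hsup a b hne; exact ⟨h1, h2, h3, h4, h5, by omega⟩,
        hrow, hcol⟩

/-! ### Soundness: the corner run, completed through the giants, is a witness -/

/-- the giants among `0..M` are `Ico (j′+1) (M+1)`. -/
theorem sum_range_ite_giant (j' M : ℕ) (φ : ℕ → ℝ) :
    ∑ b ∈ Finset.range (M + 1), (if j' + 1 ≤ b ∧ b ≤ M then φ b else 0) = ∑ b ∈ Finset.Ico (j' + 1) (M + 1), φ b := by
  rw [← Finset.sum_filter]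
  congr 1
  ext b
  simp only [Finset.mem_filter, Finset.mem_range, Finset.mem_Ico]
  omega

/-- the lows among `0..j′`. -/
theorem sum_range_ite_low (T : ℝ) (j' : ℕ) (φ : ℕ → ℝ) :
    ∑ a ∈ Finset.range (j' + 1), (if a ≤ j' ∧ 2 * (a : ℝ) < T then φ a else 0)
      = ∑ a ∈ (Finset.range (j' + 1)).filter (fun a : ℕ => 2 * (a : ℝ) < T), φ a := by
  rw [← Finset.sum_filter]
  congr 1
  ext a
  simp only [Finset.mem_filter, Finset.mem_range]
  constructor
  · rintro ⟨h1, -, h3⟩; exact ⟨h1, h3⟩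
  · rintro ⟨h1, h3⟩; exact ⟨h1, by omega, h3⟩

/-- **SOUNDNESS OF THE CORNER CERTIFICATE** (`CornerSucceeds → FlowAtT`; `0 < x < 1`, nonnegative law): the witness is the corner flow
into the mids plus the leftovers of the lows split over the giants proportionally to their masses. [this work] -/
theorem flowAtT_of_cornerSucceeds (x T : ℝ) (j' M : ℕ) (μ : ℕ → ℝ) (hx0 : 0 < x) (hx1 : x < 1) (hμ : ∀ k, 0 ≤ μ k)
    (hC : CornerSucceeds x T j' M μ) : FlowAtT x T j' M μ := by
  obtain ⟨h0, hsup, hrow, hcol⟩ := cornerFlow_inv x T j' M μ hx0 hx1 hμ ((j' + 1) * (j' + 1)) le_rfl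
  unfold CornerSucceeds at hC
  generalize hS : ∑ l ∈ (Finset.range (j' + 1)).filter (fun l : ℕ => 2 * (l : ℝ) < T), cornerLeftover x T j' M μ l = S at hC
  generalize hG : ∑ h ∈ Finset.Ico (j' + 1) (M + 1), μ h = G at hC
  have h1x : 0 < 1 - x := by linarith
  have hxr : 0 < x / (1 - x) := div_pos hx0 h1x
  have hleft0 : ∀ l, 0 ≤ cornerLeftover x T j' M μ l := by
    intro l; unfold cornerLeftover cornerMidFlow; linarith [hrow l]
  have hS0 : 0 ≤ S := by rw [← hS]; exact Finset.sum_nonneg (fun l _ => hleft0 l)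
  have hG0 : 0 ≤ G := by rw [← hG]; exact Finset.sum_nonneg (fun h _ => hμ h)
  -- the giant split: coefficient, low part, giant part
  have hc0 : 0 ≤ (if G = 0 then (0:ℝ) else 1 / G) := by
    split_ifs
    · exact le_rfl
    · exact div_nonneg zero_le_one hG0
  have hL0 : ∀ a, 0 ≤ (if a ≤ j' ∧ 2 * (a : ℝ) < T then cornerLeftover x T j' M μ a else 0) := by
    intro a; split_ifs
    · exact hleft0 a
    · exact le_rfl
  have hW0 : ∀ b, 0 ≤ (if j' + 1 ≤ b ∧ b ≤ M then μ b else 0) := by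
    intro b; split_ifs
    · exact hμ b
    · exact le_rfl
  refine ⟨fun a b => cornerMidFlow x T j' M μ a b
    + (if G = 0 then (0:ℝ) else 1 / G) * (if a ≤ j' ∧ 2 * (a : ℝ) < T then cornerLeftover x T j' M μ a else 0)
        * (if j' + 1 ≤ b ∧ b ≤ M then μ b else 0), ?_, ?_, ?_, ?_⟩
  · -- nonnegativity
    intro a b
    have hF := h0 a b
    have := mul_nonneg (mul_nonneg hc0 (hL0 a)) (hW0 b)
    unfold cornerMidFlow
    linarith
  · -- support
    intro a b hpos
    dsimp only at hpos
    by_cases hF : cornerMidFlow x T j' M μ a b = 0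
    · rw [hF, zero_add] at hpos
      have hlow : a ≤ j' ∧ 2 * (a : ℝ) < T := by
        by_contra hn; rw [if_neg hn, mul_zero, zero_mul] at hpos; exact lt_irrefl _ hpos
      have hgiant : j' + 1 ≤ b ∧ b ≤ M := by
        by_contra hn; rw [if_neg hn, mul_zero] at hpos; exact lt_irrefl _ hpos
      exact ⟨hlow.1, hlow.2, hgiant.2, Or.inl hgiant.1⟩
    · obtain ⟨h1, -, h3, h4, h5, -⟩ := hsup a b hF
      exact ⟨h1, h3, h4, Or.inr h5⟩
  · -- rows: corner flow + leftover
    intro a haj halow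
    dsimp only
    rw [Finset.sum_add_distrib, ← Finset.mul_sum, if_pos (show a ≤ j' ∧ 2 * (a : ℝ) < T from ⟨haj, halow⟩),
      sum_range_ite_giant j' M μ, hG]
    have hFa : ∑ b ∈ Finset.range (M + 1), cornerMidFlow x T j' M μ a b = μ a - cornerLeftover x T j' M μ a := by
      unfold cornerLeftover; ring
    rw [hFa]
    by_cases hG0' : G = 0
    · -- no giant mass: the certificate forces every leftover to vanish
      rw [if_pos hG0']
      have hS0' : S = 0 := by
        rw [hG0'] at hC
        have : x / (1 - x) * S ≤ 0 := hC
        nlinarith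
      have hmem : a ∈ (Finset.range (j' + 1)).filter (fun l : ℕ => 2 * (l : ℝ) < T) :=
        Finset.mem_filter.2 ⟨Finset.mem_range.2 (by omega), halow⟩
      have hz := (Finset.sum_eq_zero_iff_of_nonneg (fun l _ => hleft0 l)).1 (hS.trans hS0') a hmem
      rw [hz]; ring
    · rw [if_neg hG0']
      field_simp
      ring
  · -- columns: mids carry the corner flow only, giants the split leftovers at rate x/(1−x)
    intro b hbM hself
    dsimp only
    have e : ∀ a, usage x T j' a b * (cornerMidFlow x T j' M μ a b
        + (if G = 0 then (0:ℝ) else 1 / G) * (if a ≤ j' ∧ 2 * (a : ℝ) < T then cornerLeftover x T j' M μ a else 0)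
          * (if j' + 1 ≤ b ∧ b ≤ M then μ b else 0))
        = usage x T j' a b * cornerMidFlow x T j' M μ a b
          + ((if G = 0 then (0:ℝ) else 1 / G) * (if j' + 1 ≤ b ∧ b ≤ M then μ b else 0))
            * (usage x T j' a b * (if a ≤ j' ∧ 2 * (a : ℝ) < T then cornerLeftover x T j' M μ a else 0)) :=
      fun a => by ring
    simp only [e, Finset.sum_add_distrib]
    rw [← Finset.mul_sum]
    by_cases hgb : j' + 1 ≤ b
    · -- giant: the corner flow is absent, usage is x/(1−x)
      have hFz : ∀ a, usage x T j' a b * cornerMidFlow x T j' M μ a b = 0 := by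
        intro a
        by_cases hF : cornerMidFlow x T j' M μ a b = 0
        · rw [hF, mul_zero]
        · have := (hsup a b hF).2.1; omega
      have hug : ∀ a ∈ Finset.range (j' + 1),
          usage x T j' a b * (if a ≤ j' ∧ 2 * (a : ℝ) < T then cornerLeftover x T j' M μ a else 0)
            = x / (1 - x) * (if a ≤ j' ∧ 2 * (a : ℝ) < T then cornerLeftover x T j' M μ a else 0) := by
        intro a _; rw [usage_giant_eq x T j' a b hgb]
      rw [Finset.sum_congr rfl (fun a _ => hFz a), Finset.sum_const_zero, zero_add, Finset.sum_congr rfl hug,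
        ← Finset.mul_sum, sum_range_ite_low T j', hS, if_pos (show j' + 1 ≤ b ∧ b ≤ M from ⟨hgb, hbM⟩)]
      by_cases hG0' : G = 0
      · rw [if_pos hG0']; simp only [zero_mul]; exact hμ b
      · rw [if_neg hG0']
        have hGp : 0 < G := lt_of_le_of_ne hG0 (Ne.symm hG0')
        rw [show 1 / G * μ b * (x / (1 - x) * S) = μ b * ((x / (1 - x) * S) / G) by ring]
        have hfrac : (x / (1 - x) * S) / G ≤ 1 := by rw [div_le_one hGp]; exact hC
        nlinarith [hμ b]
    · -- mid: only the corner flow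
      have hng : ¬ (j' + 1 ≤ b ∧ b ≤ M) := fun hn => hgb hn.1
      rw [if_neg hng]
      simp only [mul_zero, zero_mul, add_zero]
      exact hcol b

/-- **the corner run succeeds ⟹ DEC(j′) at target `T`** in the flow form, for nonnegative laws. [this work] -/
theorem cornerTheorem_mpr (x T : ℝ) (j' M : ℕ) (μ : ℕ → ℝ) (hx0 : 0 < x) (hx1 : x < 1) (hμ : ∀ k, 0 ≤ μ k) :
    CornerSucceeds x T j' M μ → FlowAtT x T j' M μ :=
  flowAtT_of_cornerSucceeds x T j' M μ hx0 hx1 hμ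

end LawDec

end Quant

end Summit.CriticalPhenomena.PercolationContinuityZ3.Theorems
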